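import Literature.Analysis.FluidPDE.FluidComputer.RobustPumpCascade
import HarnessLib

/-!
# Fluid computer blueprint — ONE-SHOT witnesses and LIVENESS: what the cascade interfaces do and do not force

HONEST FRAMING: low prior, high value-of-information experiment on Tao's machine paradigm; NOT a
claim that NS blows up. Nothing in this file constructs a blow-up; every construction below turns a
HYPOTHESISED finite lifespan into an inhabitant of an interface, and every theorem is an
implication from a structure that, as far as anyone knows, is uninhabited for the true equations.

The blueprint types Tao's machine programme (J. Amer. Math. Soc. 29 (2016), §1.3) as
`CascadeWitness` (`CascadeWitness.lean`), `PumpCascade S` (`PumpCascade.lean`: one `PumpGadget` per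
generation, context-free realisation axiom `fires`, self-replication `replicate`, spec floors and
firing times) and `RobustPumpCascade S s ρ` (`RobustPumpCascade.lean`: noise tolerance `ρ` in the
scale-adapted norm `X^s`). This file records, as constructions, how LITTLE those interfaces force
as typed, and adds the one hypothesis under which they force a genuine cascade.

**One-shot witnesses (§1).** The realisation axiom `fires` is guarded by "the trajectory lives past
`t + T`". Consequently a gadget whose output class is EMPTY satisfies `fires` as soon as its input
class consists of DOOMED states (`Doomed T v`: no `H¹⁰_df`-mild Navier–Stokes trajectory, from any
datum, is alive `T` after visiting `v`), and every later generation may be IDLE (empty classes):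
`replicate`, `energy`, `time` and — in the robust interface — `margin` are then vacuous.

* `CascadeWitness.oneShot`: a Schwartz divergence-free datum ALL of whose mild trajectories have
  lifespan `≤ τ` is a cascade witness with `T_* = τ` (`oneShot_Tstar`): stage `0 = {u₀}`, all other
  stages empty. With Theorem A (`CascadeWitness.lifespan_le`) this makes "cascade witness with datum
  `u₀` and `T_* ≤ τ`" EQUIVALENT to "every mild trajectory from `u₀` has lifespan `≤ τ`" — exactly,
  with no residual gap (the summit-side file `FluidComputerOneShot.lean` states the `iff`); the
  `limsup H¹⁰` / `lim H¹` gap flagged by the earlier calibration (`FluidComputerCalibration.lean`) is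
  not there.
* `PumpCascade.oneShot S`: a datum carrying the generation-`0` floor (`∫_{|ξ|≥λ₀}|û₀|² ≥ E₀`) and
  doomed within ONE tick `T₀ = Cλ₀^{-α}` inhabits `PumpCascade S` — generation `0` = "doomed
  states with the floor", output class `∅`, generations `≥ 1` idle. No hand-off, no second scale,
  no cascade: the dyadic ladder is decorative for this inhabitant.
* `RobustPumpCascade.oneShot S s ρ`: if the `H¹⁰_df` part of the `X^s_{λ₀}`-ball of radius `ρ√E₀`
  about the datum consists of one-tick-doomed states carrying the floor, the same one-shot library
  is `ρ`-robust (`margin` speaks about output states; there are none).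

So, as typed, the three interfaces encode (uniformly) BOUNDED LIFESPAN — of one datum, resp. of an
`X^s`-ball of data — and nothing else; in particular not "energy at arbitrarily fine scales".

**Liveness (§2).** The typed difference between a cascade singularity (Tao: the averaged solution
is smooth on every `[0, t_n]` and dies only at `T_* = lim t_n`, Prop. 6.3) and a one-shot
singularity is that every gadget COMPLETES ITS CYCLE: `PumpGadget.Completes G` — every `H¹⁰_df`
input state has a mild Navier–Stokes trajectory living STRICTLY longer than the firing allowance
`T`. `PumpCascade.Live L := ∀ n, (L.G n).Completes`. The one-shot library is not live
(`PumpCascade.not_live_oneShot`), and under liveness every generation is genuinely loaded from the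
seed through a chain of mild segments (`PumpCascade.Live.exists_chain`); the summit-side file places
that chain on the seed's maximal trajectory before `T_*`: energy `≥ E₀ηⁿ` at frequencies
`≥ λ₀2ⁿ` is reached at a time `t_n ≤ ∑_{k<n} T_k < T_*` for EVERY `n` — the cascade proper, as a
theorem of the (live) interface rather than a vacuity. Liveness is an OUTPUT-side hypothesis like
the rest (it cannot see gates or wires); its physical status is discussed in the blueprint's
`ASSEMBLY.md` §2f.

## References

* T. Tao, *Finite time blowup for an averaged three-dimensional Navier–Stokes equation*, J. Amer.
  Math. Soc. 29 (2016) 601–674, arXiv:1402.0290v3: §1.3 pp. 10–11 (the machine), §6 Prop. 6.3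
  (the solution exists on every `[0,t_n]`; blow-up only at `T_* = lim t_n`). [Tao2016AveragedNS]
-/

noncomputable section

open MeasureTheory Set Filter Topology
open scoped ENNReal NNReal SchwartzMap

namespace Literature.Analysis.FluidPDE.FluidComputer

open Literature.Analysis.FluidPDE.Tao2016
open Literature.Analysis.FunctionSpaces (eFourierSobolevNorm)

/-! ### Empty time windows -/

/-- On an empty time window `[0,S)`, `S ≤ 0`, every curve is (vacuously) a mild solution from every
datum: the solution notion carries no positivity of the lifespan by itself. [folklore] -/
theorem isMildSolutionFor_Ico_of_nonpos (F : L2C → L2C → L2C → ℂ) (a : L2C) {S : ℝ} (hS : S ≤ 0)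
    (u : ℝ → L2C) : IsMildSolutionFor F a (Ico 0 S) u := by
  have he : Ico (0 : ℝ) S = ∅ := Ico_eq_empty (not_lt.2 hS)
  rw [he]
  refine ⟨fun t ht => ?_, fun t ht => ?_, fun t ht => ?_⟩ <;> simp at ht

/-! ### §1. Doomed states and one-shot witnesses -/

/-- **Doomed states.** `Doomed T v`: every `H¹⁰_df`-mild Navier–Stokes trajectory (`ν = 1`, true
Euler form), from ANY datum on ANY window `[0,S)`, that visits the state `v` at a time `t ≥ 0` has
`S ≤ t + T` — nothing is alive `T` after passing through `v`. (Context-free, like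
`PumpGadget.fires`; on the summit side, where time translation of mild solutions is available, this
is equivalent to "every mild solution FROM `v` has lifespan `≤ T`".) [folklore] -/
def Doomed (T : ℝ) (v : L2C) : Prop :=
  ∀ (a : L2C) (S : ℝ) (u : ℝ → L2C), IsMildSolutionFor eulerForm a (Ico 0 S) u →
    ∀ t : ℝ, 0 ≤ t → u t = v → S ≤ t + T

/-- Doom within `T` is doom within any `T' ≥ T`. [folklore] -/
theorem Doomed.mono {T T' : ℝ} (h : T ≤ T') {v : L2C} (hv : Doomed T v) : Doomed T' v :=
  fun a S u hu t ht htv => (hv a S u hu t ht htv).trans (by linarith)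

/-- Doom within `T` forces `T ≥ 0` (visit `v` at time `0` along the vacuous solution on the empty
window `[0,0)`). [folklore] -/
theorem Doomed.nonneg {T : ℝ} {v : L2C} (hv : Doomed T v) : 0 ≤ T := by
  have h := hv v 0 (fun _ => v) (isMildSolutionFor_Ico_of_nonpos eulerForm v le_rfl _) 0 le_rfl rfl
  simpa using h

/-- A doomed `H¹⁰_df` state's OWN mild solutions have lifespan `≤ T` (the datum-level reading; the
converse needs time translation of mild solutions and is summit-side). [folklore] -/
theorem Doomed.lifespan_le {T : ℝ} {v : L2C} (hv : Doomed T v) (h10 : MemH10df v) {S : ℝ}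
    {u : ℝ → L2C} (hu : IsMildSolutionFor eulerForm v (Ico 0 S) u) : S ≤ T := by
  by_cases hS : S ≤ 0
  · exact hS.trans hv.nonneg
  · have hS' : 0 < S := lt_of_not_ge hS
    have h0 : u 0 = v := initial_eq hu ⟨le_rfl, hS'⟩ h10
    simpa using hv v S u hu 0 le_rfl h0

/-- **The one-shot cascade witness.** A Schwartz divergence-free datum all of whose
`H¹⁰_df`-mild Navier–Stokes trajectories have lifespan `≤ τ` (`τ ≥ 0`) IS a cascade witness:
stage `0 = {u₀}` with allowance `τ`, every later stage EMPTY with allowance `0`, floors `n`. The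
realisation axiom `fires` holds because it only speaks about trajectories alive at `t + τ ≥ τ`, and
there are none. HONEST READING: `CascadeWitness` types finite lifespan and nothing else — Theorem A
(`CascadeWitness.lifespan_le`) is its exact converse. [folklore] -/
def CascadeWitness.oneShot (u₀ : 𝓢(EuclideanSpace ℝ (Fin 3), EuclideanSpace ℝ (Fin 3)))
    (hdiv : VectorCalculus.IsDivFree ⇑u₀) (h10 : MemH10df (schwartzL2 u₀)) (τ : ℝ) (hτ : 0 ≤ τ)
    (hlife : ∀ (S : ℝ) (u : ℝ → L2C),
      IsMildSolutionFor eulerForm (schwartzL2 u₀) (Ico 0 S) u → S ≤ τ) :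
    CascadeWitness where
  u₀ := u₀
  divFree := hdiv
  memH10df := h10
  stage n := if n = 0 then {schwartzL2 u₀} else ∅
  T n := if n = 0 then τ else 0
  T_nonneg n := by
    by_cases hn : n = 0 <;> simp [hn, hτ]
  summable_T := (hasSum_ite_eq 0 τ).summable
  floor n := n
  tendsto_floor := tendsto_natCast_atTop_atTop
  floor_le n v hv := by
    rcases n with _ | n
    · simp
    · simp at hv
  ignition := by simp
  fires S u hu n t ht hmem hS := by
    rcases n with _ | n
    · simp at hS
      have := hlife S u hu
      exfalso
      linarith
    · simp at hmem

/-- The one-shot witness has `T_* = τ`. [folklore] -/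
theorem CascadeWitness.oneShot_Tstar (u₀ : 𝓢(EuclideanSpace ℝ (Fin 3), EuclideanSpace ℝ (Fin 3)))
    (hdiv : VectorCalculus.IsDivFree ⇑u₀) (h10 : MemH10df (schwartzL2 u₀)) (τ : ℝ) (hτ : 0 ≤ τ)
    (hlife : ∀ (S : ℝ) (u : ℝ → L2C),
      IsMildSolutionFor eulerForm (schwartzL2 u₀) (Ico 0 S) u → S ≤ τ) :
    (CascadeWitness.oneShot u₀ hdiv h10 τ hτ hlife).Tstar = τ :=
  show ∑' n : ℕ, (if n = 0 then τ else 0) = τ from tsum_ite_eq 0 (fun _ => τ)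

/-- The one-shot witness keeps the datum. [folklore] -/
@[simp] theorem CascadeWitness.oneShot_u₀ (u₀ : 𝓢(EuclideanSpace ℝ (Fin 3), EuclideanSpace ℝ (Fin 3)))
    (hdiv : VectorCalculus.IsDivFree ⇑u₀) (h10 : MemH10df (schwartzL2 u₀)) (τ : ℝ) (hτ : 0 ≤ τ)
    (hlife : ∀ (S : ℝ) (u : ℝ → L2C),
      IsMildSolutionFor eulerForm (schwartzL2 u₀) (Ico 0 S) u → S ≤ τ) :
    (CascadeWitness.oneShot u₀ hdiv h10 τ hτ hlife).u₀ = u₀ := rfl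

/-- All stages of the one-shot witness beyond generation `0` are empty. [folklore] -/
@[simp] theorem CascadeWitness.oneShot_stage_succ
    (u₀ : 𝓢(EuclideanSpace ℝ (Fin 3), EuclideanSpace ℝ (Fin 3)))
    (hdiv : VectorCalculus.IsDivFree ⇑u₀) (h10 : MemH10df (schwartzL2 u₀)) (τ : ℝ) (hτ : 0 ≤ τ)
    (hlife : ∀ (S : ℝ) (u : ℝ → L2C),
      IsMildSolutionFor eulerForm (schwartzL2 u₀) (Ico 0 S) u → S ≤ τ) (n : ℕ) :
    (CascadeWitness.oneShot u₀ hdiv h10 τ hτ hlife).stage (n + 1) = ∅ := by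
  simp [CascadeWitness.oneShot]

/-- **The one-shot gadget** at scale `κ`: input class = the `T`-doomed states carrying energy
`≥ Ein` at frequencies `≥ κ`; output class EMPTY; firing allowance `T`. Its realisation axiom
`fires` holds BY THE GUARD: no trajectory through an input state is alive at `t + T`. [folklore] -/
def PumpGadget.oneShot (κ Ein T : ℝ) (hκ : 0 ≤ κ) (hT : 0 ≤ T) : PumpGadget where
  κ := κ
  κ_nonneg := hκ
  In := {v | ENNReal.ofReal Ein ≤ highFreqEnergy κ v ∧ Doomed T v}
  Out := ∅
  Ein := Ein
  in_floor _ hv := hv.1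
  T := T
  T_nonneg := hT
  fires a S u hu t ht hmem hS := absurd (hmem.2 a S u hu t ht rfl) (not_le.2 hS)

/-- **The idle gadget** at scale `κ`: empty input and output classes, zero firing time; every
obligation vacuous. [folklore] -/
def PumpGadget.idle (κ Ein : ℝ) (hκ : 0 ≤ κ) : PumpGadget where
  κ := κ
  κ_nonneg := hκ
  In := ∅
  Out := ∅
  Ein := Ein
  in_floor _ hv := by simp at hv
  T := 0
  T_nonneg := le_rfl
  fires a S u hu t ht hmem hS := by simp at hmem

/-- The gadgets of the one-shot library over the sheet `S`: generation `0` = the one-shot gadget at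
scale `λ₀` with floor `E₀` and allowance `T₀ = Cλ₀^{-α}`; generations `≥ 1` idle. [folklore] -/
def oneShotGadgets (S : CascadeSpecs) : ℕ → PumpGadget
  | 0 => PumpGadget.oneShot (S.lam 0) (S.Emin 0) (S.Tmax 0) (S.lam_pos 0).le (S.Tmax_nonneg 0)
  | n + 1 => PumpGadget.idle (S.lam (n + 1)) (S.Emin (n + 1)) (S.lam_pos (n + 1)).le

/-- Every output class of the one-shot library is empty. [folklore] -/
@[simp] theorem oneShotGadgets_Out (S : CascadeSpecs) (n : ℕ) : (oneShotGadgets S n).Out = ∅ := by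
  cases n <;> rfl

/-- Every input class of the one-shot library beyond generation `0` is empty. [folklore] -/
@[simp] theorem oneShotGadgets_succ_In (S : CascadeSpecs) (n : ℕ) :
    (oneShotGadgets S (n + 1)).In = ∅ := rfl

/-- The generation-`0` input class of the one-shot library: floor and one-tick doom. [folklore] -/
theorem mem_oneShotGadgets_zero_In (S : CascadeSpecs) {v : L2C} :
    v ∈ (oneShotGadgets S 0).In ↔
      ENNReal.ofReal (S.Emin 0) ≤ highFreqEnergy (S.lam 0) v ∧ Doomed (S.Tmax 0) v :=
  Iff.rfl

/-- The generation-`0` allowance of the one-shot library is one tick `T₀ = Cλ₀^{-α}`. [folklore] -/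
@[simp] theorem oneShotGadgets_zero_T (S : CascadeSpecs) : (oneShotGadgets S 0).T = S.Tmax 0 := rfl

/-- **The one-shot pump cascade.** A Schwartz divergence-free `H¹⁰_df` datum that carries the
generation-`0` floor (`∫_{|ξ|≥λ₀}|û₀|² ≥ E₀`) and is doomed within ONE tick `T₀ = Cλ₀^{-α}`
inhabits `PumpCascade S`: generation `0` is the one-shot gadget, all later generations are idle,
and `replicate` / `energy` / `time` hold vacuously or with equality. HONEST READING: as typed,
`PumpCascade S` does not force a single hand-off, let alone a cascade. [folklore] -/
def PumpCascade.oneShot (S : CascadeSpecs)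
    (u₀ : 𝓢(EuclideanSpace ℝ (Fin 3), EuclideanSpace ℝ (Fin 3)))
    (hdiv : VectorCalculus.IsDivFree ⇑u₀) (h10 : MemH10df (schwartzL2 u₀))
    (hfloor : ENNReal.ofReal (S.Emin 0) ≤ highFreqEnergy (S.lam 0) (schwartzL2 u₀))
    (hdoom : Doomed (S.Tmax 0) (schwartzL2 u₀)) : PumpCascade S where
  G := oneShotGadgets S
  scale n := by cases n <;> rfl
  replicate n := by simp
  energy n := by cases n <;> exact le_rfl
  time n := by
    cases n with
    | zero => exact le_rfl
    | succ n => exact S.Tmax_nonneg _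
  u₀ := u₀
  divFree := hdiv
  memH10df := h10
  ignite := (mem_oneShotGadgets_zero_In S).2 ⟨hfloor, hdoom⟩

/-- The one-shot pump cascade's gadgets. [folklore] -/
@[simp] theorem PumpCascade.oneShot_G (S : CascadeSpecs)
    (u₀ : 𝓢(EuclideanSpace ℝ (Fin 3), EuclideanSpace ℝ (Fin 3)))
    (hdiv : VectorCalculus.IsDivFree ⇑u₀) (h10 : MemH10df (schwartzL2 u₀))
    (hfloor : ENNReal.ofReal (S.Emin 0) ≤ highFreqEnergy (S.lam 0) (schwartzL2 u₀))
    (hdoom : Doomed (S.Tmax 0) (schwartzL2 u₀)) :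
    (PumpCascade.oneShot S u₀ hdiv h10 hfloor hdoom).G = oneShotGadgets S := rfl

/-- The one-shot pump cascade's ignition datum. [folklore] -/
@[simp] theorem PumpCascade.oneShot_u₀ (S : CascadeSpecs)
    (u₀ : 𝓢(EuclideanSpace ℝ (Fin 3), EuclideanSpace ℝ (Fin 3)))
    (hdiv : VectorCalculus.IsDivFree ⇑u₀) (h10 : MemH10df (schwartzL2 u₀))
    (hfloor : ENNReal.ofReal (S.Emin 0) ≤ highFreqEnergy (S.lam 0) (schwartzL2 u₀))
    (hdoom : Doomed (S.Tmax 0) (schwartzL2 u₀)) :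
    (PumpCascade.oneShot S u₀ hdiv h10 hfloor hdoom).u₀ = u₀ := rfl

/-- **The one-shot robust pump cascade.** If, in addition, every `H¹⁰_df` state within
`X^s_{λ₀}`-distance `ρ√E₀` of the datum carries the floor and is doomed within one tick, the
one-shot library is `ρ`-robust in `X^s`: `margin` quantifies over output states, of which there are
none, and `igniteBall` is the hypothesis. HONEST READING: as typed, `RobustPumpCascade S s ρ` types
a BALL of data with uniformly bounded lifespan (plus a floor) — stable bounded lifespan — and no
cascade. [folklore] -/
def RobustPumpCascade.oneShot (S : CascadeSpecs) (s ρ : ℝ)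
    (u₀ : 𝓢(EuclideanSpace ℝ (Fin 3), EuclideanSpace ℝ (Fin 3)))
    (hdiv : VectorCalculus.IsDivFree ⇑u₀) (h10 : MemH10df (schwartzL2 u₀))
    (hfloor : ENNReal.ofReal (S.Emin 0) ≤ highFreqEnergy (S.lam 0) (schwartzL2 u₀))
    (hdoom : Doomed (S.Tmax 0) (schwartzL2 u₀))
    (hball : ∀ w : L2C, MemH10df w →
      scaledSobolevNorm s (S.lam 0) (w - schwartzL2 u₀) < ENNReal.ofReal (ρ * Real.sqrt (S.Emin 0)) →
        ENNReal.ofReal (S.Emin 0) ≤ highFreqEnergy (S.lam 0) w ∧ Doomed (S.Tmax 0) w) :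
    RobustPumpCascade S s ρ where
  toPumpCascade := PumpCascade.oneShot S u₀ hdiv h10 hfloor hdoom
  margin n v hv w hw hlt := by simp [PumpCascade.oneShot_G, oneShotGadgets_Out] at hv
  igniteBall w hw hlt := (mem_oneShotGadgets_zero_In S).2 (hball w hw hlt)

/-- The one-shot robust pump cascade's underlying pump cascade. [folklore] -/
@[simp] theorem RobustPumpCascade.oneShot_toPumpCascade (S : CascadeSpecs) (s ρ : ℝ)
    (u₀ : 𝓢(EuclideanSpace ℝ (Fin 3), EuclideanSpace ℝ (Fin 3)))
    (hdiv : VectorCalculus.IsDivFree ⇑u₀) (h10 : MemH10df (schwartzL2 u₀))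
    (hfloor : ENNReal.ofReal (S.Emin 0) ≤ highFreqEnergy (S.lam 0) (schwartzL2 u₀))
    (hdoom : Doomed (S.Tmax 0) (schwartzL2 u₀))
    (hball : ∀ w : L2C, MemH10df w →
      scaledSobolevNorm s (S.lam 0) (w - schwartzL2 u₀) < ENNReal.ofReal (ρ * Real.sqrt (S.Emin 0)) →
        ENNReal.ofReal (S.Emin 0) ≤ highFreqEnergy (S.lam 0) w ∧ Doomed (S.Tmax 0) w) :
    (RobustPumpCascade.oneShot S s ρ u₀ hdiv h10 hfloor hdoom hball).toPumpCascade =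
      PumpCascade.oneShot S u₀ hdiv h10 hfloor hdoom := rfl

/-! ### §2. Liveness: every gadget completes its cycle -/

/-- **A gadget completes its cycle** (LIVENESS): every `H¹⁰_df` input state has SOME
`H¹⁰_df`-mild Navier–Stokes trajectory living strictly longer than the firing allowance `T` — the
loaded machine runs for at least one tick before any singularity. For Tao's averaged equation this
is a theorem at every generation (the solution exists on every `[0, t_n]`, Prop. 6.3); for the true
equations it is a scale-critical local-regularity hypothesis on the designed class (the mild
theory's guaranteed lifespan on `In n` is far shorter than `T_n` at large `n`). It is what
distinguishes a CASCADE singularity from a one-shot one. [cite: Tao2016AveragedNS, §6 Prop. 6.3] -/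
def PumpGadget.Completes (G : PumpGadget) : Prop :=
  ∀ v ∈ G.In, MemH10df v → ∃ S : ℝ, G.T < S ∧ ∃ u : ℝ → L2C, IsMildSolutionFor eulerForm v (Ico 0 S) u

/-- **A live pump cascade**: every generation's gadget completes its cycle. [cite: Tao2016AveragedNS, §6 Prop. 6.3] -/
def PumpCascade.Live {S : CascadeSpecs} (L : PumpCascade S) : Prop := ∀ n, (L.G n).Completes

/-- **The one-shot library is not live**: its generation-`0` gadget is loaded with the (doomed)
datum, which has no trajectory outliving the tick. [folklore] -/
theorem PumpCascade.not_live_oneShot (S : CascadeSpecs)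
    (u₀ : 𝓢(EuclideanSpace ℝ (Fin 3), EuclideanSpace ℝ (Fin 3)))
    (hdiv : VectorCalculus.IsDivFree ⇑u₀) (h10 : MemH10df (schwartzL2 u₀))
    (hfloor : ENNReal.ofReal (S.Emin 0) ≤ highFreqEnergy (S.lam 0) (schwartzL2 u₀))
    (hdoom : Doomed (S.Tmax 0) (schwartzL2 u₀)) :
    ¬ (PumpCascade.oneShot S u₀ hdiv h10 hfloor hdoom).Live := by
  intro hlive
  obtain ⟨S', hS', u, hu⟩ :=
    hlive 0 (schwartzL2 u₀) ((mem_oneShotGadgets_zero_In S).2 ⟨hfloor, hdoom⟩) h10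
  have hS'' : S.Tmax 0 < S' := hS'
  have hpos : 0 < S' := (S.Tmax_pos 0).trans hS''
  have h0 : u 0 = schwartzL2 u₀ := initial_eq hu ⟨le_rfl, hpos⟩ h10
  have := hdoom (schwartzL2 u₀) S' u hu 0 le_rfl h0
  linarith

/-- **One step of a live cascade**: a loaded `H¹⁰_df` state of generation `n` is carried, by some
mild Navier–Stokes trajectory FROM it and within the allowance `T_n`, to a loaded `H¹⁰_df` state of
generation `n+1` (`Completes` gives a trajectory outliving the tick, `fires` an output state on it,
`replicate` its admission at the next generation). [cite: Tao2016AveragedNS, §1.3 pp. 10–11] -/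
theorem PumpCascade.Live.step {S : CascadeSpecs} {L : PumpCascade S} (hlive : L.Live) (n : ℕ)
    {v : L2C} (hv : v ∈ (L.G n).In) (h10 : MemH10df v) :
    ∃ (S' : ℝ) (u : ℝ → L2C) (s : ℝ), IsMildSolutionFor eulerForm v (Ico 0 S') u ∧
      0 ≤ s ∧ s ≤ (L.G n).T ∧ s < S' ∧ u s ∈ (L.G (n + 1)).In ∧ MemH10df (u s) := by
  obtain ⟨S', hS', u, hu⟩ := hlive n v hv h10
  have hpos : 0 < S' := (L.G n).T_nonneg.trans_lt hS'
  have h0 : u 0 = v := initial_eq hu ⟨le_rfl, hpos⟩ h10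
  obtain ⟨s, h0s, hsT, hs⟩ :=
    (L.G n).fires v S' u hu 0 le_rfl (by rw [h0]; exact hv) (by simpa using hS')
  have hsS : s < S' := by linarith
  exact ⟨S', u, s, hu, h0s, by simpa using hsT, hsS, L.replicate n hs, hu.1 s ⟨h0s, hsS⟩⟩

/-- **Under liveness every generation is loaded, from the seed, through a chain of mild segments**:
there are `H¹⁰_df` states `v n ∈ In n` with `v 0 = u₀`, each carried to the next by a mild
Navier–Stokes trajectory from it within the allowance `T_n`. (The summit side glues the chain onto
the seed's maximal trajectory, at times `≤ ∑_{k<n} T_k < T_*`.) [cite: Tao2016AveragedNS, §1.3 pp. 10–11] -/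
theorem PumpCascade.Live.exists_chain {S : CascadeSpecs} {L : PumpCascade S} (hlive : L.Live) :
    ∃ v : ℕ → L2C, v 0 = schwartzL2 L.u₀ ∧ ∀ n, v n ∈ (L.G n).In ∧ MemH10df (v n) ∧
      ∃ (S' : ℝ) (u : ℝ → L2C) (s : ℝ), IsMildSolutionFor eulerForm (v n) (Ico 0 S') u ∧
        0 ≤ s ∧ s ≤ (L.G n).T ∧ s < S' ∧ u s = v (n + 1) := by
  classical
  -- the loaded states of generation `n`, as a subtype, and the successor map given by `step`
  let X : ℕ → Type := fun n => {w : L2C // w ∈ (L.G n).In ∧ MemH10df w}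
  have hstep : ∀ n (x : X n), ∃ y : X (n + 1), ∃ (S' : ℝ) (u : ℝ → L2C) (s : ℝ),
      IsMildSolutionFor eulerForm x.1 (Ico 0 S') u ∧ 0 ≤ s ∧ s ≤ (L.G n).T ∧ s < S' ∧ u s = y.1 := by
    intro n x
    obtain ⟨S', u, s, hu, h0s, hsT, hsS, hmem, h10⟩ := hlive.step n x.2.1 x.2.2
    exact ⟨⟨u s, hmem, h10⟩, S', u, s, hu, h0s, hsT, hsS, rfl⟩
  choose next hnext using hstep
  let x : (n : ℕ) → X n := fun n => Nat.rec (motive := X) ⟨schwartzL2 L.u₀, L.ignite, L.memH10df⟩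
    (fun k xk => next k xk) n
  refine ⟨fun n => (x n).1, rfl, fun n => ⟨(x n).2.1, (x n).2.2, ?_⟩⟩
  obtain ⟨S', u, s, hu, h0s, hsT, hsS, heq⟩ := hnext n (x n)
  exact ⟨S', u, s, hu, h0s, hsT, hsS, heq⟩

/-- **Under liveness every input class carries a state with the spec's high-frequency energy**:
for every `n` some `H¹⁰_df` state reachable from the seed has `∫_{|ξ|≥λ₀2ⁿ}|v̂|² ≥ E₀ηⁿ`. [cite: Tao2016AveragedNS, §1.3 pp. 10–11] -/
theorem PumpCascade.Live.exists_loaded {S : CascadeSpecs} {L : PumpCascade S} (hlive : L.Live)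
    (n : ℕ) : ∃ v ∈ (L.G n).In, MemH10df v ∧
      ENNReal.ofReal (S.Emin n) ≤ highFreqEnergy (S.lam n) v := by
  obtain ⟨v, -, hv⟩ := hlive.exists_chain
  refine ⟨v n, (hv n).1, (hv n).2.1, ?_⟩
  have h := (L.G n).in_floor (v n) (hv n).1
  rw [L.scale n] at h
  exact (ENNReal.ofReal_le_ofReal (L.energy n)).trans h

end Literature.Analysis.FluidPDE.FluidComputer

end
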